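import Literature.Barriers.CriticalPhenomena.FKParafermionicHalfCauchyRiemann

/-!
# Twin regrouping on the medial lattice of `ℤ²` (stub `stub_regroup`, line `Sketch`)

Crux `CardySusyWard.WeakHolomorphy` (stmt-CriticalPhenomena-11292), line `Sketch`: the exact
summation-by-parts identity on the medial lattice. Medial vertices are indexed by
`p = (x, i) : Site 2 × Fin 2`; the four medial edges (corners) at `p` are
`medialCornersAt p.1 p.2 k`, `k : Fin 4`. Each corner is incident to exactly two medial vertices,
`p` and `HalfCRGreen.twin p.1 p.2 k`, and seen from the twin it is the antipodal corner `k + 2`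
(`HalfCRGreen.medialCornersAt_twin`, `HalfCRGreen.twin_twin`). Hence the map
`(p, k) ↦ (twin p k, k + 2)` is a corner-preserving involution of `(Site 2 × Fin 2) × Fin 4`, and
a vertex-indexed sum `∑_{p ∈ S} ∑_k w p k · Φ(corner)` whose weight support is twin-closed in `S`
equals half the sum of the symmetrised weights `w p k + w (twin p k) (k + 2)` (`stub_regroup`).
Pure finite algebra (`Finset.sum_filter_of_ne`, `Finset.sum_product`, `Finset.sum_nbij'`).
-/

noncomputable section

namespace Summit.CriticalPhenomena.CardyFormulaZ2.Theorems.WeakHolomorphy.SplitBypass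

open scoped BigOperators
open _root_.Literature.Probability.LatticeModels
open _root_.Literature.Barriers.CriticalPhenomena (medialCornersAt medialVertexOf halfCRForm HalfCRRelationAt)
open _root_.Literature.Barriers.CriticalPhenomena.HalfCRGreen (coeff twin)

/-- `Fin 4` arithmetic: the antipode of the antipode is the original corner index. [folklore] -/
private theorem fin4_add_two_add_two (k : Fin 4) : k + 2 + 2 = k := by
  fin_cases k <;> rfl

/-- The twin map `(p, k) ↦ (twin p k, k + 2)` on `(Site 2 × Fin 2) × Fin 4` is an involution
(`HalfCRGreen.twin_twin` and `k + 2 + 2 = k`). [folklore] -/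
private theorem twinMap_twinMap (a : (Site 2 × Fin 2) × Fin 4) :
    (twin (twin a.1.1 a.1.2 a.2).1 (twin a.1.1 a.1.2 a.2).2 (a.2 + 2), a.2 + 2 + 2) = a := by
  obtain ⟨⟨x, i⟩, k⟩ := a
  exact Prod.ext (_root_.Literature.Barriers.CriticalPhenomena.HalfCRGreen.twin_twin x i k)
    (fin4_add_two_add_two k)

/-- The twin map preserves the twin-closed part `{(p, k) ∈ S × Fin 4 | twin p k ∈ S}` of a
finite set `S` of medial vertices. [folklore] -/
private theorem twinMap_mem {S : Finset (Site 2 × Fin 2)} {a : (Site 2 × Fin 2) × Fin 4}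
    (ha : a ∈ (S ×ˢ (Finset.univ : Finset (Fin 4))).filter
      (fun a => twin a.1.1 a.1.2 a.2 ∈ S)) :
    (twin a.1.1 a.1.2 a.2, a.2 + 2) ∈ (S ×ˢ (Finset.univ : Finset (Fin 4))).filter
      (fun a => twin a.1.1 a.1.2 a.2 ∈ S) := by
  obtain ⟨⟨x, i⟩, k⟩ := a
  simp only [Finset.mem_filter, Finset.mem_product, Finset.mem_univ, and_true] at ha ⊢
  rw [_root_.Literature.Barriers.CriticalPhenomena.HalfCRGreen.twin_twin]
  exact ⟨ha.2, ha.1⟩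

/-- **Twin reindexing.** Under the twin-closed support hypothesis, the vertex-indexed sum of
`w p k · Φ(corner)` equals the same sum with the weight read from the twin medial vertex at the
antipodal index: both sums live on the twin-closed part of `S × Fin 4`, on which
`(p, k) ↦ (twin p k, k + 2)` is an involution preserving the corner
(`HalfCRGreen.medialCornersAt_twin`, `HalfCRGreen.twin_twin`). [folklore] -/
theorem sum_twin_reindex (S : Finset (Site 2 × Fin 2)) (w : Site 2 × Fin 2 → Fin 4 → ℂ)
    (Φ : Site 2 × Site 2 → ℂ)
    (hw : ∀ (p : Site 2 × Fin 2) (k : Fin 4), w p k ≠ 0 → p ∈ S ∧ twin p.1 p.2 k ∈ S) :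
    ∑ p ∈ S, ∑ k : Fin 4, w (twin p.1 p.2 k) (k + 2) * Φ (medialCornersAt p.1 p.2 k) =
      ∑ p ∈ S, ∑ k : Fin 4, w p k * Φ (medialCornersAt p.1 p.2 k) := by
  classical
  have hA : ∑ p ∈ S, ∑ k : Fin 4, w p k * Φ (medialCornersAt p.1 p.2 k) =
      ∑ a ∈ (S ×ˢ (Finset.univ : Finset (Fin 4))).filter
          (fun a => twin a.1.1 a.1.2 a.2 ∈ S),
        w a.1 a.2 * Φ (medialCornersAt a.1.1 a.1.2 a.2) := by
    rw [Finset.sum_filter_of_ne, Finset.sum_product]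
    rintro ⟨p, k⟩ _ h
    exact (hw p k (left_ne_zero_of_mul h)).2
  have hB :
      ∑ p ∈ S, ∑ k : Fin 4, w (twin p.1 p.2 k) (k + 2) * Φ (medialCornersAt p.1 p.2 k) =
      ∑ a ∈ (S ×ˢ (Finset.univ : Finset (Fin 4))).filter
          (fun a => twin a.1.1 a.1.2 a.2 ∈ S),
        w (twin a.1.1 a.1.2 a.2) (a.2 + 2) * Φ (medialCornersAt a.1.1 a.1.2 a.2) := by
    rw [Finset.sum_filter_of_ne, Finset.sum_product]
    rintro ⟨p, k⟩ _ h
    exact (hw _ _ (left_ne_zero_of_mul h)).1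
  rw [hA, hB]
  refine Finset.sum_nbij' (fun a => (twin a.1.1 a.1.2 a.2, a.2 + 2))
    (fun a => (twin a.1.1 a.1.2 a.2, a.2 + 2)) (fun a ha => twinMap_mem ha)
    (fun a ha => twinMap_mem ha) (fun a _ => twinMap_twinMap a) (fun a _ => twinMap_twinMap a)
    ?_
  rintro ⟨⟨x, i⟩, k⟩ _
  rw [_root_.Literature.Barriers.CriticalPhenomena.HalfCRGreen.medialCornersAt_twin]

/-- **`stub_regroup` — exact twin regrouping (finite algebra).** Every medial edge (corner) is the
`k`-th corner of exactly one horizontal and one vertical medial vertex, antipodally indexed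
(`HalfCRGreen.medialCornersAt_twin`, `twin_twin`); so a vertex-indexed sum of weights times
corner values is half the sum of the symmetrised weights, as soon as the weight support is
twin-closed in `S`. [folklore] -/
theorem stub_regroup : ∀ (S : Finset (Site 2 × Fin 2)) (w : Site 2 × Fin 2 → Fin 4 → ℂ)
    (Φ : Site 2 × Site 2 → ℂ),
    (∀ (p : Site 2 × Fin 2) (k : Fin 4), w p k ≠ 0 → p ∈ S ∧ twin p.1 p.2 k ∈ S) →
    ∑ p ∈ S, ∑ k : Fin 4, w p k * Φ (medialCornersAt p.1 p.2 k) =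
      (1 / 2 : ℂ) * ∑ p ∈ S, ∑ k : Fin 4,
        (w p k + w (twin p.1 p.2 k) (k + 2)) * Φ (medialCornersAt p.1 p.2 k) := by
  intro S w Φ hw
  have hsplit : ∑ p ∈ S, ∑ k : Fin 4,
      (w p k + w (twin p.1 p.2 k) (k + 2)) * Φ (medialCornersAt p.1 p.2 k) =
      ∑ p ∈ S, ∑ k : Fin 4, w p k * Φ (medialCornersAt p.1 p.2 k) +
        ∑ p ∈ S, ∑ k : Fin 4,
          w (twin p.1 p.2 k) (k + 2) * Φ (medialCornersAt p.1 p.2 k) := by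
    simp only [add_mul, Finset.sum_add_distrib]
  rw [hsplit, sum_twin_reindex S w Φ hw]
  ring

end Summit.CriticalPhenomena.CardyFormulaZ2.Theorems.WeakHolomorphy.SplitBypass

end
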